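import Summits.CriticalPhenomena.SAWScalingLimit.Theorems.SAWRenewalTightnessShellCrossingBoundTubeMassConcat
import Summits.CriticalPhenomena.SAWScalingLimit.Theorems.SAWRenewalTightnessShellCrossingBoundTubeMassReverse
import Mathlib.Analysis.SpecificLimits.Basic

/-!
# `ShellCrossingBound`, line `kesten-defect-renewal`, stub S3 `stub_tubeMass_of_stripDecay`:
# amplitude removal for the critical mass of strip bridges (Madras–Slade Lemmas 4.1.11–4.1.12)

Crux item `stmt-CriticalPhenomena-4728` (`SAWRenewalTightness.ShellCrossingBound`), registered stub
`stub_tubeMass_of_stripDecay` (an unconditional implication). Write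
`P(N; W, y, y', L) = Σ_{n ≤ N} Σ_ω x_c^n` for the partial sums of the critical mass of the strip
bridges of width `W` and span `L` from height `y` to height `y'` (`ω ∈ SAW.Zd.bridges 2 n`,
`ω n 0 = L`, `y + ω n 1 = y'`, `0 ≤ y + ω i 1 < W` for `i ≤ n`; always the explicit
`Finset.filter` of the line skeleton). **Claim:** if `P(N; W, y, y', L) ≤ A · W · e^{-cL/W}` for
all `W ≥ 1`, `0 ≤ y, y' < W`, `L ≥ 1`, `N` (amplitude linear in `W`), then
`P(N; W, y, y', L) ≤ x_c^{-1/2} · e^{-cL/W}` (same rate, absolute amplitude). This is the rate form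
of `TubeMassHyperscaling`, `W · M_W(x_c) ≥ c`, which Madras–Slade Lemma 4.1.11 (`M_T(z_c) ↓ 0`)
leaves open; here it is only the removal of the amplitude, valid for any rate.

## Proof

* Diagonal (`stripBridgeMass_pow_le`, `stripBridgeMass_diag_le`): by supermultiplicativity of the
  confined mass under concatenation (`stripBridgeMass_mul_le`, file `…TubeMassConcat`),
  `P(N; W, y, y, L)^k ≤ P(kN; W, y, y, kL) ≤ A W (e^{-cL/W})^k` for every `k ≥ 1`, and the root
  test `le_of_pow_le_mul_pow` (`a^k ≤ B b^k ∀ k ⟹ a ≤ b`, the finite form of Fekete's lemma used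
  in Madras–Slade (4.1.16)) gives `P(N; W, y, y, L) ≤ e^{-cL/W}` with amplitude ONE.
* Off the diagonal (`criticalFugacity_mul_stripBridgeMass_sq_le`, Madras–Slade Lemma 4.1.12): a
  strip bridge `y → y'` of span `L`, one step `e₁`, and the mirror image of a second strip bridge
  `y → y'` of span `L` run backwards form a strip bridge `y → y` of span `2L + 1`, injectively
  (`criticalFugacity_mul_stripBridgeMass_le`, file `…TubeMassReverse`, then `stripBridgeMass_mul_le`),
  so `x_c · P(N; W, y, y', L)² ≤ P(2N+1; W, y, y, 2L+1) ≤ e^{-c(2L+1)/W} ≤ (e^{-cL/W})²`.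

References: N. Madras, G. Slade, *The Self-Avoiding Walk* (1993), Lemma 4.1.11, Lemma 4.1.12,
eq. (4.1.16), eq. (1.2.15).
-/

open Finset Filter Literature.Probability.LatticeModels Literature.Probability.RandomPlanarGeometry
open scoped BigOperators Classical Topology

namespace Summit.CriticalPhenomena.SAWScalingLimit.Theorems

namespace TubeMass

/-! ### The root test (finite Fekete) -/

/-- **Root test.** If `a^k ≤ B · b^k` for every `k ≥ 1` (`b ≥ 0`), then `a ≤ b`: otherwise
`(a/b)^k → ∞`. This is the amplitude-removal step of Fekete's lemma for a supermultiplicative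
sequence dominated by `B · b^k`. [folklore] -/
theorem le_of_pow_le_mul_pow {a b B : ℝ} (hb : 0 ≤ b) (h : ∀ k : ℕ, 1 ≤ k → a ^ k ≤ B * b ^ k) :
    a ≤ b := by
  by_contra hlt
  rw [not_le] at hlt
  rcases hb.eq_or_lt with rfl | hb0
  · have := h 1 le_rfl
    rw [pow_one, pow_one, mul_zero] at this
    exact absurd (this.trans_lt hlt) (lt_irrefl a)
  · have hr : 1 < a / b := (one_lt_div hb0).2 hlt
    obtain ⟨k, hkB, hk1⟩ := (((tendsto_pow_atTop_atTop_of_one_lt hr).eventually_gt_atTop B).and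
      (eventually_ge_atTop 1)).exists
    have hbk : 0 < b ^ k := pow_pos hb0 k
    have := h k hk1
    rw [div_pow, lt_div_iff₀ hbk] at hkB
    linarith

/-! ### The diagonal: supermultiplicativity and amplitude one -/

/-- `P(N; W, y, y, L)^k ≤ P(kN; W, y, y, kL)` for `k ≥ 1`, `L ≥ 1`: iterate the concatenation
bound `stripBridgeMass_mul_le`. [cite: MadrasSlade1993, §1.2, eq. (1.2.15)] -/
theorem stripBridgeMass_pow_le (W : ℕ) (y : ℤ) {L : ℕ} (hL : 1 ≤ L) (N : ℕ) :
    ∀ k : ℕ, 1 ≤ k →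
      (∑ n ∈ Finset.range (N + 1),
        ∑ _ω ∈ (SAW.Zd.bridges 2 n).filter (fun ω =>
            ω n 0 = (L : ℤ) ∧ y + ω n 1 = y ∧ ∀ i ≤ n, 0 ≤ y + ω i 1 ∧ y + ω i 1 < W),
          SAW.criticalFugacity ^ n) ^ k ≤
      ∑ n ∈ Finset.range (k * N + 1),
        ∑ _ω ∈ (SAW.Zd.bridges 2 n).filter (fun ω =>
            ω n 0 = ((k * L : ℕ) : ℤ) ∧ y + ω n 1 = y ∧ ∀ i ≤ n, 0 ≤ y + ω i 1 ∧ y + ω i 1 < W),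
          SAW.criticalFugacity ^ n := by
  have hxc : 0 ≤ SAW.criticalFugacity := SAW.criticalFugacity_pos.le
  have hP0 : 0 ≤ ∑ n ∈ Finset.range (N + 1),
      ∑ _ω ∈ (SAW.Zd.bridges 2 n).filter (fun ω =>
          ω n 0 = (L : ℤ) ∧ y + ω n 1 = y ∧ ∀ i ≤ n, 0 ≤ y + ω i 1 ∧ y + ω i 1 < W),
        SAW.criticalFugacity ^ n :=
    Finset.sum_nonneg fun n _ => Finset.sum_nonneg fun _ _ => pow_nonneg hxc n
  intro k hk
  induction k, hk using Nat.le_induction with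
  | base => simp only [pow_one, one_mul, le_refl]
  | succ k hk ih =>
    rw [pow_succ]
    refine le_trans (mul_le_mul_of_nonneg_right ih hP0) ?_
    exact stripBridgeMass_mul_le W y y y (k * L) L ((k + 1) * L) hL (by ring) (k * N) N
      ((k + 1) * N) (le_of_eq (by ring))

/-- **Amplitude one on the diagonal** (the rate form of Madras–Slade Lemma 4.1.11 / (4.1.16)):
if `P(N; W, y, y, L) ≤ A · W · e^{-cL/W}` for all `L ≥ 1` and `N`, then
`P(N; W, y, y, L) ≤ e^{-cL/W}` for all `L ≥ 1` and `N` — from `stripBridgeMass_pow_le` and the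
root test. [cite: MadrasSlade1993, Lemma 4.1.11] -/
theorem stripBridgeMass_diag_le {c A : ℝ} {W : ℕ} {y : ℤ}
    (hA : ∀ L : ℕ, 1 ≤ L → ∀ N : ℕ,
      (∑ n ∈ Finset.range (N + 1),
        ∑ _ω ∈ (SAW.Zd.bridges 2 n).filter (fun ω =>
            ω n 0 = (L : ℤ) ∧ y + ω n 1 = y ∧ ∀ i ≤ n, 0 ≤ y + ω i 1 ∧ y + ω i 1 < W),
          SAW.criticalFugacity ^ n) ≤ A * W * Real.exp (-(c * L / W)))
    {L : ℕ} (hL : 1 ≤ L) (N : ℕ) :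
    (∑ n ∈ Finset.range (N + 1),
      ∑ _ω ∈ (SAW.Zd.bridges 2 n).filter (fun ω =>
          ω n 0 = (L : ℤ) ∧ y + ω n 1 = y ∧ ∀ i ≤ n, 0 ≤ y + ω i 1 ∧ y + ω i 1 < W),
        SAW.criticalFugacity ^ n) ≤ Real.exp (-(c * L / W)) := by
  refine le_of_pow_le_mul_pow (B := A * W) (Real.exp_pos _).le fun k hk => ?_
  refine (stripBridgeMass_pow_le W y hL N k hk).trans ?_
  refine (hA (k * L) (hL.trans (Nat.le_mul_of_pos_left L hk)) (k * N)).trans (le_of_eq ?_)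
  have : -(c * ((k * L : ℕ) : ℝ) / W) = (k : ℕ) * -(c * L / W) := by
    push_cast
    ring
  rw [this, Real.exp_nat_mul]

/-! ### Off the diagonal: reflect and Schwarz (Madras–Slade Lemma 4.1.12) -/

/-- **`x_c · P(N; W, y, y', L)² ≤ P(2N+1; W, y, y, 2L+1)`** (Madras–Slade Lemma 4.1.12 for strip
bridges at `z = x_c`): the pair (strip bridge `y → y'` of span `L`, mirrored reversal of a strip
bridge `y → y'` of span `L` preceded by one step `e₁`) concatenates, injectively, to a strip bridge
`y → y` of span `2L + 1` with one extra step. [cite: MadrasSlade1993, Lemma 4.1.12] -/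
theorem criticalFugacity_mul_stripBridgeMass_sq_le (W : ℕ) (y y' : ℤ) (L N : ℕ) :
    SAW.criticalFugacity *
      (∑ n ∈ Finset.range (N + 1),
        ∑ _ω ∈ (SAW.Zd.bridges 2 n).filter (fun ω =>
            ω n 0 = (L : ℤ) ∧ y + ω n 1 = y' ∧ ∀ i ≤ n, 0 ≤ y + ω i 1 ∧ y + ω i 1 < W),
          SAW.criticalFugacity ^ n) ^ 2 ≤
    ∑ n ∈ Finset.range (2 * N + 1 + 1),
      ∑ _ω ∈ (SAW.Zd.bridges 2 n).filter (fun ω =>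
          ω n 0 = ((2 * L + 1 : ℕ) : ℤ) ∧ y + ω n 1 = y ∧ ∀ i ≤ n, 0 ≤ y + ω i 1 ∧ y + ω i 1 < W),
        SAW.criticalFugacity ^ n := by
  have hxc : 0 ≤ SAW.criticalFugacity := SAW.criticalFugacity_pos.le
  have hP0 : 0 ≤ ∑ n ∈ Finset.range (N + 1),
      ∑ _ω ∈ (SAW.Zd.bridges 2 n).filter (fun ω =>
          ω n 0 = (L : ℤ) ∧ y + ω n 1 = y' ∧ ∀ i ≤ n, 0 ≤ y + ω i 1 ∧ y + ω i 1 < W),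
        SAW.criticalFugacity ^ n :=
    Finset.sum_nonneg fun n _ => Finset.sum_nonneg fun _ _ => pow_nonneg hxc n
  have h1 := criticalFugacity_mul_stripBridgeMass_le W y y' L (L + 1) rfl N (N + 1) le_rfl
  have h2 := stripBridgeMass_mul_le W y y' y L (L + 1) (2 * L + 1) (by omega) (by ring) N (N + 1)
    (2 * N + 1) (by omega)
  rw [sq, ← mul_assoc, mul_comm SAW.criticalFugacity, mul_assoc]
  exact (mul_le_mul_of_nonneg_left h1 hP0).trans h2

end TubeMass

/-! ### The registered stub -/

open TubeMass in
/-- **S3 — amplitude removal (`stub_tubeMass_of_stripDecay`, line `kesten-defect-renewal` of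
crux `ShellCrossingBound`).** If the critical mass of strip bridges satisfies
`P(N; W, y, y', L) ≤ A · W · e^{-cL/W}` (all `W ≥ 1`, `0 ≤ y, y' < W`, `L ≥ 1`, `N`), then
`P(N; W, y, y', L) ≤ A' · e^{-cL/W}` with the same rate `c` and the absolute amplitude
`A' = x_c^{-1/2}`: Fekete on the diagonal (`stripBridgeMass_diag_le`, amplitude one at span
`2L + 1`) and reflect-and-Schwarz off the diagonal (`criticalFugacity_mul_stripBridgeMass_sq_le`),
`x_c P² ≤ e^{-c(2L+1)/W} ≤ (e^{-cL/W})²`. An unconditional implication (`TubeMassHyperscaling`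
from any bound with amplitude linear in `W`). [cite: MadrasSlade1993, Lemma 4.1.12] -/
theorem stub_tubeMass_of_stripDecay :
    (∃ c : ℝ, 0 < c ∧ ∃ A : ℝ, ∀ W : ℕ, 1 ≤ W → ∀ y y' : ℤ, 0 ≤ y → y < W → 0 ≤ y' → y' < W →
      ∀ L : ℕ, 1 ≤ L → ∀ N : ℕ,
        (∑ n ∈ Finset.range (N + 1),
          ∑ _ω ∈ (SAW.Zd.bridges 2 n).filter (fun ω =>
              ω n 0 = (L : ℤ) ∧ y + ω n 1 = y' ∧ ∀ i ≤ n, 0 ≤ y + ω i 1 ∧ y + ω i 1 < W),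
            SAW.criticalFugacity ^ n) ≤ A * W * Real.exp (-(c * L / W))) →
    ∃ c : ℝ, 0 < c ∧ ∃ A : ℝ, ∀ W : ℕ, 1 ≤ W → ∀ y y' : ℤ, 0 ≤ y → y < W → 0 ≤ y' → y' < W →
      ∀ L : ℕ, 1 ≤ L → ∀ N : ℕ,
        (∑ n ∈ Finset.range (N + 1),
          ∑ _ω ∈ (SAW.Zd.bridges 2 n).filter (fun ω =>
              ω n 0 = (L : ℤ) ∧ y + ω n 1 = y' ∧ ∀ i ≤ n, 0 ≤ y + ω i 1 ∧ y + ω i 1 < W),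
            SAW.criticalFugacity ^ n) ≤ A * Real.exp (-(c * L / W)) := by
  rintro ⟨c, hc, A, hA⟩
  refine ⟨c, hc, (Real.sqrt SAW.criticalFugacity)⁻¹, ?_⟩
  intro W hW y y' hy hyW _hy' _hy'W L _hL N
  have hxc : 0 < SAW.criticalFugacity := SAW.criticalFugacity_pos
  have hs : 0 < Real.sqrt SAW.criticalFugacity := Real.sqrt_pos.2 hxc
  have hWpos : (0 : ℝ) < W := by exact_mod_cast hW
  -- amplitude one on the diagonal, at span `2L + 1`
  have hdiag := stripBridgeMass_diag_le (fun L' hL' N' => hA W hW y y hy hyW hy hyW L' hL' N')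
    (L := 2 * L + 1) (by omega) (2 * N + 1)
  -- reflect and Schwarz
  have hsq := criticalFugacity_mul_stripBridgeMass_sq_le W y y' L N
  have hexp : Real.exp (-(c * ((2 * L + 1 : ℕ) : ℝ) / W)) ≤ Real.exp (-(c * L / W)) ^ 2 := by
    rw [← Real.exp_nat_mul, Real.exp_le_exp]
    push_cast
    have h' : c * (2 * (L : ℝ) + 1) / W = 2 * (c * L / W) + c / W := by ring
    rw [h']
    linarith [div_nonneg hc.le hWpos.le]
  set P := ∑ n ∈ Finset.range (N + 1),
      ∑ _ω ∈ (SAW.Zd.bridges 2 n).filter (fun ω =>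
          ω n 0 = (L : ℤ) ∧ y + ω n 1 = y' ∧ ∀ i ≤ n, 0 ≤ y + ω i 1 ∧ y + ω i 1 < W),
        SAW.criticalFugacity ^ n with hP
  have hP0 : 0 ≤ P := Finset.sum_nonneg fun n _ => Finset.sum_nonneg fun _ _ => pow_nonneg hxc.le n
  have key : (Real.sqrt SAW.criticalFugacity * P) ^ 2 ≤ Real.exp (-(c * L / W)) ^ 2 := by
    rw [mul_pow, Real.sq_sqrt hxc.le]
    exact hsq.trans (hdiag.trans hexp)
  have key2 : Real.sqrt SAW.criticalFugacity * P ≤ Real.exp (-(c * L / W)) :=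
    (pow_le_pow_iff_left₀ (mul_nonneg hs.le hP0) (Real.exp_pos _).le two_ne_zero).1 key
  calc P = (Real.sqrt SAW.criticalFugacity)⁻¹ * (Real.sqrt SAW.criticalFugacity * P) := by
        rw [← mul_assoc, inv_mul_cancel₀ hs.ne', one_mul]
    _ ≤ (Real.sqrt SAW.criticalFugacity)⁻¹ * Real.exp (-(c * L / W)) :=
        mul_le_mul_of_nonneg_left key2 (inv_nonneg.2 hs.le)

end Summit.CriticalPhenomena.SAWScalingLimit.Theorems
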